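import Summits.ResolutionOfSingularities.ResolutionOfSingularities.Theorems.FrobeniusLadderFInjectiveMacaulayficationCIConeFiModel
import HarnessLib

/-!
# c.i.-CN CERTIFICATES (hoff-free): the CI-CN engine's `hon` block in the E6‴ certificate format of T-𝒫
# (crux `FInjectiveMacaulayfication`, CRUX-PLAN w45a v10 §2.3(c) / §5 row stub-1; seat res-L1-w45a-stub-1)

[OURS · L1 W4.5a] Support file for crux stmt-ResolutionOfSingularities-15315. AI-written, weaker than expert review; no statement of
[claim: Hironaka2017] is used. The T-𝒫 programme (`L/w45a/ClassGlueSig.lean` v2 §2–§3) consumes, for an affine chart ring `R` with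
centre `I` and cover family `v`, the certificate block
`CERT(R, I, v) := irrelevant(reesGrading I) ≤ √(reesT (v c) : c) ∧ (∀ c, v c ≠ 0) ∧ (∀ c, ∀ Q maximal in R[I/v c] ∋ v c/1, clause at R[I/v c]_Q)`
(E6‴ `BlowupFiModelOfCover`'s input) together with the zero locus of `I`. This file exposes that block for the c.i.-CN engine
(`CIConeFiModel.ciConeFiModelRel`, p506828) — its binders MINUS `hoff` — exactly as stub-5's §3b `CNCertificates` does for the CN engine:
* `centre_le_iff` — zero locus: for a prime `P` of `R = k[X]/(F)`, `I_A·R ≤ P ↔ ∀ j ∈ J, x̄ⱼ ∈ P` (every exponent of `A` involves a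
  `J`-variable; a pure power of every `J`-variable lies in `A`); with `J` such that `V(X_J) ∩ X` is a point this is the point-supported
  case T-𝒫 2.3(c) asks for;
* `ciCertificates` — CERT(`k[X]/(F)`, `I_A·R`, `x̄^(m c)`) from the chart data and the per-chart naive-quotient hypothesis `hon'`
  (orbit binder ∧ clause at the maximal `Q'` of `k[Y]/(g_c)` containing `θ_c(X_j)`, `j ∈ J`): cover by `ReesCoverOfPowers` from `hcov`,
  `x̄^(m c) ≠ 0` by `CIConeFiModelCore.mk_monomial_ne_zero`, clause by `CIConeFiModel.chartClause_of_quotientChartClause`.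
No definitions, no named facts. [folklore]
-/

set_option linter.dupNamespace false

noncomputable section

open AlgebraicGeometry CategoryTheory Literature.AlgebraicGeometry.Resolution MvPolynomial

namespace Summit.ResolutionOfSingularities.ResolutionOfSingularities.Theorems.FInjectiveMacaulayfication.CICertificates

open Summit.ResolutionOfSingularities.ResolutionOfSingularities.Theorems.FInjectiveMacaulayfication

/-- **Zero locus of the monomial centre on `X = V(F)`.** If every exponent of `A` involves a `J`-variable and `A` contains a pure power of
every `J`-variable, then for a prime `P` of `k[X]/F`: `I_A·R ≤ P ↔ ∀ j ∈ J, x̄ⱼ ∈ P`. [folklore] -/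
theorem centre_le_iff {n : ℕ} {k : Type} [Field k] (F : Ideal (MvPolynomial (Fin n) k)) (J : Finset (Fin n))
    (A : Finset (Fin n →₀ ℕ)) (hAJ : ∀ a ∈ A, ∃ j ∈ J, 0 < a j) (hprim : ∀ j ∈ J, ∃ N : ℕ, Finsupp.single j N ∈ A)
    (P : Ideal (MvPolynomial (Fin n) k ⧸ F)) [P.IsPrime] :
    Ideal.span ((fun e : Fin n →₀ ℕ => Ideal.Quotient.mk F (monomial e (1 : k))) '' (A : Set (Fin n →₀ ℕ))) ≤ P ↔
      ∀ j ∈ J, Ideal.Quotient.mk F (X j) ∈ P := by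
  constructor
  · intro hle j hj
    obtain ⟨N, hN⟩ := hprim j hj
    refine Ideal.IsPrime.mem_of_pow_mem ‹_› N (hle (Ideal.subset_span ⟨_, hN, ?_⟩))
    rw [← map_pow, X_pow_eq_monomial]
  · intro hX
    rw [Ideal.span_le]
    rintro _ ⟨b, hb, rfl⟩
    obtain ⟨j, hj, hbj⟩ := hAJ b hb
    have hle : Finsupp.single j 1 ≤ b := Finsupp.single_le_iff.mpr hbj
    have heq : (monomial b (1 : k) : MvPolynomial (Fin n) k) = monomial (b - Finsupp.single j 1) (1 : k) * X j := by
      rw [X, monomial_mul, mul_one, tsub_add_cancel_of_le hle]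
    show Ideal.Quotient.mk F (monomial b (1 : k)) ∈ P
    rw [heq, map_mul]
    exact Ideal.mul_mem_left _ _ (hX j hj)

section Chart

variable (p : ℕ) {n : ℕ} (k : Type) [Field k]

/-- **c.i.-CN CERTIFICATES (hoff-free)** — the `hon` block of `CIConeFiModel.ciConeFiModelRel` in the E6‴/T-𝒫 certificate format
`CERT(k[X]/(F), I_A·R, x̄^(m c))`: cover inequality in the Rees algebra, `x̄^(m c) ≠ 0`, and the Cohen–Macaulay + Frobenius-closed clause at
every maximal ideal of every chart `R[I_A R/x̄^(m c)]` containing `x̄^(m c)/1` — from the chart data and the naive-quotient hypothesis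
`hon'` (smooth route: `CIConeFiModelSmooth.quotientChartClause_of_smoothFaceCertificates`). [folklore] -/
theorem ciCertificates (J : Finset (Fin n))
    (A : Finset (Fin n →₀ ℕ)) (hprim : ∀ j ∈ J, ∃ N : ℕ, Finsupp.single j N ∈ A)
    (t : ℕ) (m : Fin t → (Fin n →₀ ℕ))
    (hcov : ∀ a ∈ A, ∃ (c : Fin t) (K : ℕ), 1 ≤ K ∧ ∃ y ∈ (Ideal.span ((fun b : Fin n →₀ ℕ => (MvPolynomial.monomial b (1 : k) : MvPolynomial (Fin n) k)) '' (A : Set (Fin n →₀ ℕ)))) ^ (K - 1),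
      (MvPolynomial.monomial a (1 : k) : MvPolynomial (Fin n) k) ^ K = MvPolynomial.monomial (m c) 1 * y)
    (V : Fin t → Matrix (Fin n) (Fin n) ℕ) (hV : ∀ c, IsUnit ((V c).map (Nat.cast : ℕ → ℤ)).det)
    (a : Fin t → Fin n → (Fin n →₀ ℕ)) (haA : ∀ c i, a c i ∈ A)
    (hgen : ∀ (c : Fin t) (i : Fin n), (Finsupp.equivFunOnFinite.symm ((V c).mulVec ⇑(a c i)) : Fin n →₀ ℕ) =
      Finsupp.equivFunOnFinite.symm ((V c).mulVec ⇑(m c)) + Finsupp.single i 1)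
    (hge : ∀ (c : Fin t), ∀ e ∈ A, (Finsupp.equivFunOnFinite.symm ((V c).mulVec ⇑(m c)) : Fin n →₀ ℕ) ≤
      Finsupp.equivFunOnFinite.symm ((V c).mulVec ⇑e))
    {r : ℕ} (Fs : Fin r → MvPolynomial (Fin n) k) (hprime : (Ideal.span (Set.range Fs)).IsPrime)
    (hXne : ∀ v : Fin n, Ideal.Quotient.mk (Ideal.span (Set.range Fs)) (MvPolynomial.X v) ≠ 0)
    (gs : Fin t → Fin r → MvPolynomial (Fin n) k) (d : Fin t → Fin r → (Fin n →₀ ℕ))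
    (hθF : ∀ (c : Fin t) (l : Fin r), aeval (fun j : Fin n => ∏ i : Fin n, (X i : MvPolynomial (Fin n) k) ^ V c i j) (Fs l) =
      monomial (d c l) (1 : k) * gs c l)
    (hunit : ∀ (c : Fin t) (l : Fin r), ∃ (N : ℕ) (r' : Fin n →₀ ℕ), N • m c = ∑ j : Fin n, d c l j • a c j + r')
    (hon' : ∀ (c : Fin t) (Q' : Ideal (MvPolynomial (Fin n) k ⧸ Ideal.span (Set.range (gs c)))) [Q'.IsMaximal],
      (∀ j ∈ J, Ideal.Quotient.mk (Ideal.span (Set.range (gs c)))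
        (aeval (fun j : Fin n => ∏ i : Fin n, (X i : MvPolynomial (Fin n) k) ^ V c i j) (X j : MvPolynomial (Fin n) k)) ∈ Q') →
        (∀ i : Fin n, (X i : MvPolynomial (Fin n) k) ∈ Q'.comap (Ideal.Quotient.mk (Ideal.span (Set.range (gs c)))) →
          IsSMulRegular (Localization.AtPrime (Q'.comap (Ideal.Quotient.mk (Ideal.span (Set.range (gs c))))) ⧸
              (Ideal.span (Set.range (gs c))).map (algebraMap (MvPolynomial (Fin n) k)
                (Localization.AtPrime (Q'.comap (Ideal.Quotient.mk (Ideal.span (Set.range (gs c))))))))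
            (algebraMap (MvPolynomial (Fin n) k)
              (Localization.AtPrime (Q'.comap (Ideal.Quotient.mk (Ideal.span (Set.range (gs c)))))) (X i))) ∧
        ∀ dd : ℕ, ringKrullDim (Localization.AtPrime Q') = dd → ∀ s : Fin dd → Localization.AtPrime Q',
          (Ideal.span (Set.range s)).radical.IsMaximal →
            RingTheory.Sequence.IsWeaklyRegular (Localization.AtPrime Q') (List.ofFn s) ∧
            ∀ y : Localization.AtPrime Q', (∃ e : ℕ, y ^ p ^ e ∈ Ideal.span
              ((fun z : Localization.AtPrime Q' => z ^ p ^ e) ''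
                (Ideal.span (Set.range s) : Set (Localization.AtPrime Q')))) → y ∈ Ideal.span (Set.range s))
    (hv : ∀ c : Fin t, Ideal.Quotient.mk (Ideal.span (Set.range Fs)) (monomial (m c) (1 : k)) ∈ (Ideal.span ((fun e : Fin n →₀ ℕ => Ideal.Quotient.mk (Ideal.span (Set.range Fs)) (monomial e (1 : k))) '' (A : Set (Fin n →₀ ℕ))))) :
    (HomogeneousIdeal.irrelevant (reesGrading (Ideal.span ((fun e : Fin n →₀ ℕ => Ideal.Quotient.mk (Ideal.span (Set.range Fs)) (monomial e (1 : k))) '' (A : Set (Fin n →₀ ℕ)))))).toIdeal ≤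
        (Ideal.span (Set.range fun c : Fin t => reesT (I := (Ideal.span ((fun e : Fin n →₀ ℕ => Ideal.Quotient.mk (Ideal.span (Set.range Fs)) (monomial e (1 : k))) '' (A : Set (Fin n →₀ ℕ)))))
          (Ideal.Quotient.mk (Ideal.span (Set.range Fs)) (monomial (m c) (1 : k))) (hv c))).radical ∧
      (∀ c : Fin t, Ideal.Quotient.mk (Ideal.span (Set.range Fs)) (monomial (m c) (1 : k)) ≠ 0) ∧
      ∀ (c : Fin t) (Q : Ideal ↥(blowupAlgebra (Ideal.span ((fun e : Fin n →₀ ℕ => Ideal.Quotient.mk (Ideal.span (Set.range Fs)) (monomial e (1 : k))) '' (A : Set (Fin n →₀ ℕ)))) (Ideal.Quotient.mk (Ideal.span (Set.range Fs)) (monomial (m c) (1 : k))))) [Q.IsMaximal],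
        algebraMap (MvPolynomial (Fin n) k ⧸ Ideal.span (Set.range Fs)) ↥(blowupAlgebra (Ideal.span ((fun e : Fin n →₀ ℕ => Ideal.Quotient.mk (Ideal.span (Set.range Fs)) (monomial e (1 : k))) '' (A : Set (Fin n →₀ ℕ)))) (Ideal.Quotient.mk (Ideal.span (Set.range Fs)) (monomial (m c) (1 : k)))) (Ideal.Quotient.mk (Ideal.span (Set.range Fs)) (monomial (m c) (1 : k))) ∈ Q →
        ∀ dd : ℕ, ringKrullDim (Localization.AtPrime Q) = dd → ∀ s : Fin dd → Localization.AtPrime Q,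
          (Ideal.span (Set.range s)).radical.IsMaximal →
            RingTheory.Sequence.IsWeaklyRegular (Localization.AtPrime Q) (List.ofFn s) ∧
            ∀ y : Localization.AtPrime Q, (∃ e : ℕ, y ^ p ^ e ∈ Ideal.span
              ((fun z : Localization.AtPrime Q => z ^ p ^ e) ''
                (Ideal.span (Set.range s) : Set (Localization.AtPrime Q)))) → y ∈ Ideal.span (Set.range s) := by
  haveI := hprime
  refine ⟨?_, fun c => CIConeFiModelCore.mk_monomial_ne_zero (Ideal.span (Set.range Fs)) hXne (m c), fun c Q _ hu => ?_⟩
  · -- THE COVER, read off the identities `(x^a)^K = x^(m c) · y`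
    have hImap : (Ideal.span ((fun e : Fin n →₀ ℕ => Ideal.Quotient.mk (Ideal.span (Set.range Fs)) (monomial e (1 : k))) '' (A : Set (Fin n →₀ ℕ)))) =
        (Ideal.span ((fun b : Fin n →₀ ℕ => (MvPolynomial.monomial b (1 : k) : MvPolynomial (Fin n) k)) '' (A : Set (Fin n →₀ ℕ)))).map
          (Ideal.Quotient.mk (Ideal.span (Set.range Fs))) := by
      rw [Ideal.map_span, Set.image_image]
    refine ReesCoverOfPowers.stub_reesCoverOfPowers _ _ (Ideal.Quotient.mk (Ideal.span (Set.range Fs)) '' ((fun b : Fin n →₀ ℕ =>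
      (MvPolynomial.monomial b (1 : k) : MvPolynomial (Fin n) k)) '' (A : Set (Fin n →₀ ℕ)))) (by rw [hImap, Ideal.map_span]) t _ hv ?_
    rintro _ ⟨_, ⟨a', ha', rfl⟩, rfl⟩
    obtain ⟨c, K, hK, y, hy, hEq⟩ := hcov a' ha'
    refine ⟨c, K, hK, Ideal.Quotient.mk (Ideal.span (Set.range Fs)) y, ?_, ?_⟩
    · rw [hImap, ← Ideal.map_pow]
      exact Ideal.mem_map_of_mem _ hy
    · rw [← map_pow, hEq, map_mul]
  · exact CIConeFiModel.chartClause_of_quotientChartClause p (V c) (hV c) (m c) (a c) (hgen c) A (haA c) (hge c) J hprim Fs (gs c)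
      (d c) (hθF c) (hunit c) (hon' c) Q hu

end Chart

end Summit.ResolutionOfSingularities.ResolutionOfSingularities.Theorems.FInjectiveMacaulayfication.CICertificates

end
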